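import Summits.Parity.GeneralizedHardyLittlewood.Theorems.CosetDecorrelation.Negative.CosetDecorrelationWindow
import Summits.Parity.GeneralizedHardyLittlewood.Theorems.DilatedChowla.Negative.DilatedChowlaMirrorDefs
import Literature.Barriers.Parity.SiegelZeroDichotomyPairHLStepTwo

/-!
# STRATEGY CENSUS — typed objects for `CosetDecorrelation` (stmt-Parity-13317)

Companion of `STRATEGY-CENSUS.md` (crux-strategist, unit `cstrat-stmt-Parity-13317-p1`, 2026-08-17).
Every statement the census names under STRENGTHEN / DECOMPOSITION / NEGATION is typed here over existing
declarations; the glue and the calibrations are PROVED (no `sorry`).  Nothing here asserts the crux or its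
negation.  Notation: `T c n n' M j` = the crux's coset sum (`Negative.T`), `u n c m = λ(mn+c)`.

* §S STRENGTHEN.  `CosetSqrtStrong` (S⁺₁: exponent `3/4+ε` for every `ε > 0`, ALL moduli `j ≥ ⌊√M⌋+1`, ALL
  dilations `n ≠ n'`): `→ CosetDecorrelation` (trivial) and `→ DilatedChowla` POINTWISE (at `j = M+1` the coset is
  the diagonal) — the strengthening swallows the node it was meant to serve, so as a hypothesis it is dominated;
  `AffineFamilyCoset` (S⁺₂: all affine images of `ℤ/j`, Buchstab-closed) — signature.
* §D DECOMPOSITION.  D2 `CosetPrimeModuli ∧ CosetCompositeModuli ↔ crux` (glue PROVED); D1 small/large dilations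
  is `JacobiFamily.cosetDecorrelation_iff_small_large` (SketchIdeator4, PROVED there); D3 mean/fluctuation is the dead
  `K2 → K1` (p108330); the irreducible core every split isolates: `PureSecondLevelCore η` (K1 at prime `j`,
  `nn' ≤ M^η`) — signature; D5 `CosetOnAverage`/`CosetColumnRigidity` — signatures + glue PROVED.
* §N NEGATION.  `not_siegelZerosAbove_rpow`: Siegel-compatible exceptional zeros have quality `< q^ε`
  (Siegel's theorem, tree), so the Tao–Teräväinen pretender route to `¬ crux` (which needs quality `≥ q²`
  infinitely often, census N2) is vacuous; the one conditional disproof is the strategist mirror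
  (`StrategistMirror.CosetDecorrelation_false_of_siegelZerosAbove`, logarithmic quality).
-/

noncomputable section

namespace Summit.Parity.GeneralizedHardyLittlewood.Cruxes.CosetDecorrelation.StrategyCensus

open Finset
open Summit.Parity.GeneralizedHardyLittlewood.Theses.LiouvilleMAD (CosetDecorrelation DilatedChowla)
open Summit.Parity.GeneralizedHardyLittlewood.Theorems.CosetDecorrelation.Negative
  (u cosetW T crux_iff abs_u_le_one large_modulus_eq_diagonal)
open Summit.Parity.GeneralizedHardyLittlewood.Theorems.DilatedChowla.Negative (SiegelZerosAbove)
open Literature.Barriers.Parity (IsSiegelZero exists_siegelZero_quality_le)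

/-! ## §S STRENGTHEN -/

/-- **S⁺₁ `CosetSqrtStrong`** — square-root cancellation at exponent `3/4 + ε` for EVERY `ε > 0`, for ALL
moduli `j ≥ ⌊√M⌋+1` (no upper window) and ALL dilation pairs `1 ≤ n ≠ n'` (no bound `≤ 2M`). -/
def CosetSqrtStrong : Prop :=
  ∀ c : ℤ, c ≠ 0 → ∀ ε : ℝ, 0 < ε → ∃ C : ℝ, ∀ M n n' j : ℕ, 1 ≤ n → 1 ≤ n' → n ≠ n' →
    Nat.sqrt M + 1 ≤ j → |T c n n' M j| ≤ C * (M : ℝ) ^ (3 / 4 + ε)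

/-- S⁺₁ implies the crux (take `ε = 1/8`). -/
theorem cosetDecorrelation_of_sqrtStrong (h : CosetSqrtStrong) : CosetDecorrelation := by
  rw [crux_iff]
  intro c hc
  obtain ⟨C, hC⟩ := h c hc (1 / 8) (by norm_num)
  exact ⟨1 / 8, by norm_num, C, fun M n n' j h1 h2 h3 _ _ h6 _ => hC M n n' j h1 h2 h3 h6⟩

/-- **Domination.** S⁺₁ implies the NODE `DilatedChowla` pointwise and directly (no fans, no divisor
switch): at the modulus `j = M + 1 > M` the coset is the diagonal and `T = Σ_m λ(mn+c)λ(mn'+c)`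
(`large_modulus_eq_diagonal`), so `|S| ≤ C·M^{3/4+1/8} = C·M^{1−1/8}`. -/
theorem dilatedChowla_of_sqrtStrong (h : CosetSqrtStrong) : DilatedChowla := by
  intro c hc
  obtain ⟨C, hC⟩ := h c hc (1 / 8) (by norm_num)
  refine ⟨1 / 8, by norm_num, C, fun M n n' h1 h2 h3 _ _ => ?_⟩
  have hj : Nat.sqrt M + 1 ≤ M + 1 := Nat.succ_le_succ (Nat.sqrt_le_self M)
  have hb := hC M n n' (M + 1) h1 h2 h3 hj
  have hdiag : T c n n' M (M + 1) =
      ∑ m ∈ Ioc M (2 * M), u n c m * u n' c m := large_modulus_eq_diagonal _ _ M (M + 1) (by omega)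
  rw [hdiag] at hb
  have hexp : (3 / 4 + 1 / 8 : ℝ) = 1 - 1 / 8 := by norm_num
  rw [hexp] at hb
  exact hb

/-- **S⁺₂ `AffineFamilyCoset`** — decorrelation of the two class profiles under EVERY affine map
`a ↦ ρa + σ` of `ℤ/j` (`ρ` a unit), not only the crux's `(ρ, σ) = (1, 0)`; `n = n'` is allowed when
`(ρ, σ) ≠ (1, 0)`.  Closed under the Buchstab decomposition `λ(x) = −λ(x/p)` (the dilations `(p, p')` inside
the congruence are an affine image), which is the only self-similar structure found — but the recursion's
error term is the sieve dimension (Ideator5Memo §2.S(i)). -/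
def AffineFamilyCoset : Prop :=
  ∀ c : ℤ, c ≠ 0 → ∃ ϑ : ℝ, ϑ < 1 / 4 ∧ ∃ C : ℝ, ∀ M n n' j ρ σ : ℕ, 1 ≤ n → 1 ≤ n' →
    n ≤ 2 * M → n' ≤ 2 * M → Nat.sqrt M + 1 ≤ j → j < 2 * (Nat.sqrt M + 1) → Nat.Coprime ρ j →
    (n ≠ n' ∨ ρ % j ≠ 1 % j ∨ σ % j ≠ 0) →
      |∑ a ∈ range j,
          (∑ m ∈ (Ioc M (2 * M)).filter (fun m => m ≡ a [MOD j]), u n c m) *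
            (∑ m ∈ (Ioc M (2 * M)).filter (fun m => m ≡ (ρ * a + σ) % j [MOD j]), u n' c m)|
        ≤ C * (M : ℝ) ^ (3 / 4 + ϑ)

/-! ## §D DECOMPOSITION -/

/-- D2, piece 1: the crux at PRIME moduli of the window (one exists for every `M`, Bertrand).  Here the
`q ∣ j` pretender clause is void and no Ramanujan shell layer exists: the "pure second level". -/
def CosetPrimeModuli : Prop :=
  ∀ c : ℤ, c ≠ 0 → ∃ ϑ : ℝ, ϑ < 1 / 4 ∧ ∃ C : ℝ, ∀ M n n' j : ℕ, 1 ≤ n → 1 ≤ n' → n ≠ n' →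
    n ≤ 2 * M → n' ≤ 2 * M → Nat.sqrt M + 1 ≤ j → j < 2 * (Nat.sqrt M + 1) → j.Prime →
      |T c n n' M j| ≤ C * (M : ℝ) ^ (3 / 4 + ϑ)

/-- D2, piece 2: the crux at COMPOSITE moduli of the window (shell layer + pretender-sensitive). -/
def CosetCompositeModuli : Prop :=
  ∀ c : ℤ, c ≠ 0 → ∃ ϑ : ℝ, ϑ < 1 / 4 ∧ ∃ C : ℝ, ∀ M n n' j : ℕ, 1 ≤ n → 1 ≤ n' → n ≠ n' →
    n ≤ 2 * M → n' ≤ 2 * M → Nat.sqrt M + 1 ≤ j → j < 2 * (Nat.sqrt M + 1) → ¬ j.Prime →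
      |T c n n' M j| ≤ C * (M : ℝ) ^ (3 / 4 + ϑ)

theorem prime_of_cosetDecorrelation (h : CosetDecorrelation) : CosetPrimeModuli := by
  intro c hc
  obtain ⟨ϑ, hϑ, C, hC⟩ := (crux_iff.mp h) c hc
  exact ⟨ϑ, hϑ, C, fun M n n' j h1 h2 h3 h4 h5 h6 h7 _ => hC M n n' j h1 h2 h3 h4 h5 h6 h7⟩

theorem composite_of_cosetDecorrelation (h : CosetDecorrelation) : CosetCompositeModuli := by
  intro c hc
  obtain ⟨ϑ, hϑ, C, hC⟩ := (crux_iff.mp h) c hc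
  exact ⟨ϑ, hϑ, C, fun M n n' j h1 h2 h3 h4 h5 h6 h7 _ => hC M n n' j h1 h2 h3 h4 h5 h6 h7⟩

/-- GLUE for D2 (`ϑ := max`, `C := max … 0`). -/
theorem cosetDecorrelation_of_prime_composite (hP : CosetPrimeModuli) (hQ : CosetCompositeModuli) :
    CosetDecorrelation := by
  rw [crux_iff]
  intro c hc
  obtain ⟨ϑ₁, hϑ₁, C₁, hC₁⟩ := hP c hc
  obtain ⟨ϑ₂, hϑ₂, C₂, hC₂⟩ := hQ c hc
  refine ⟨max ϑ₁ ϑ₂, max_lt hϑ₁ hϑ₂, max (max C₁ C₂) 0, fun M n n' j h1 h2 h3 h4 h5 h6 h7 => ?_⟩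
  have hM : (1 : ℝ) ≤ (M : ℝ) := by exact_mod_cast (show 1 ≤ M by omega)
  have mono : ∀ (ϑ C : ℝ), ϑ ≤ max ϑ₁ ϑ₂ → C ≤ max (max C₁ C₂) 0 →
      |T c n n' M j| ≤ C * (M : ℝ) ^ (3 / 4 + ϑ) →
        |T c n n' M j| ≤ max (max C₁ C₂) 0 * (M : ℝ) ^ (3 / 4 + max ϑ₁ ϑ₂) := by
    intro ϑ C hϑ hCle hb
    have hpow : (M : ℝ) ^ (3 / 4 + ϑ) ≤ (M : ℝ) ^ (3 / 4 + max ϑ₁ ϑ₂) :=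
      Real.rpow_le_rpow_of_exponent_le hM (by linarith)
    have hpos : 0 ≤ (M : ℝ) ^ (3 / 4 + ϑ) := Real.rpow_nonneg (by positivity) _
    calc |T c n n' M j| ≤ C * (M : ℝ) ^ (3 / 4 + ϑ) := hb
      _ ≤ max (max C₁ C₂) 0 * (M : ℝ) ^ (3 / 4 + ϑ) := mul_le_mul_of_nonneg_right hCle hpos
      _ ≤ max (max C₁ C₂) 0 * (M : ℝ) ^ (3 / 4 + max ϑ₁ ϑ₂) :=
          mul_le_mul_of_nonneg_left hpow (le_max_right _ _)
  by_cases hp : j.Prime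
  · exact mono ϑ₁ C₁ (le_max_left _ _) ((le_max_left _ _).trans (le_max_left _ _))
      (hC₁ M n n' j h1 h2 h3 h4 h5 h6 h7 hp)
  · exact mono ϑ₂ C₂ (le_max_right _ _) ((le_max_right _ _).trans (le_max_left _ _))
      (hC₂ M n n' j h1 h2 h3 h4 h5 h6 h7 hp)

theorem cosetDecorrelation_iff_prime_composite :
    CosetDecorrelation ↔ CosetPrimeModuli ∧ CosetCompositeModuli :=
  ⟨fun h => ⟨prime_of_cosetDecorrelation h, composite_of_cosetDecorrelation h⟩,
    fun h => cosetDecorrelation_of_prime_composite h.1 h.2⟩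

/-- **The irreducible core `K1°`** (what every split isolates): the MEAN-CORRECTED coset sum at PRIME moduli
and SMALL dilation products `nn' ≤ M^η` — immune to `q ∣ j` pretenders, to `ζ` (level-1 term removed) and,
heuristically, to every zero of conductor `≤ M^{1/6}` (Ideator5Memo §1.2); beyond GRH by exactly the crux's
margin `M^κ`; no tool in print addresses it.  Signature only. -/
def PureSecondLevelCore (η : ℝ) : Prop :=
  ∀ c : ℤ, c ≠ 0 → ∃ ϑ : ℝ, ϑ < 1 / 4 ∧ ∃ C : ℝ, ∀ M n n' j : ℕ, 1 ≤ n → 1 ≤ n' → n ≠ n' →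
    (n : ℝ) * n' ≤ (M : ℝ) ^ η → j.Prime → Nat.sqrt M + 1 ≤ j → j < 2 * (Nat.sqrt M + 1) →
      |T c n n' M j -
          (∑ m ∈ Ioc M (2 * M), u n c m) * (∑ m ∈ Ioc M (2 * M), u n' c m) / (j : ℝ)|
        ≤ C * (M : ℝ) ^ (3 / 4 + ϑ)

/-- D5, piece 1: the crux ON AVERAGE over the window `J = [Q, 2Q)`, `Q = ⌊√M⌋+1` — this is all the route
consumes (by `DivisorSwitch`, `Σ_{j∈J} T_j = Q·S + Σ_{k≠0} R_k`, it follows from `DilatedChowla ∧ FanDecorrelation`). -/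
def CosetOnAverage : Prop :=
  ∀ c : ℤ, c ≠ 0 → ∃ ϑ : ℝ, ϑ < 1 / 4 ∧ ∃ C : ℝ, ∀ M n n' : ℕ, 1 ≤ n → 1 ≤ n' → n ≠ n' →
    n ≤ 2 * M → n' ≤ 2 * M →
      |∑ j ∈ Ico (Nat.sqrt M + 1) (2 * (Nat.sqrt M + 1)), T c n n' M j|
        ≤ C * (Nat.sqrt M + 1 : ℕ) * (M : ℝ) ^ (3 / 4 + ϑ)

/-- D5, piece 2: COLUMN RIGIDITY of the array `F(tj)` — any two moduli of the window give the same coset sum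
up to `M^{3/4+ϑ}`.  This is exactly what the crux adds over the node; no handle of its own (Ideator5Memo §2.D(a)). -/
def CosetColumnRigidity : Prop :=
  ∀ c : ℤ, c ≠ 0 → ∃ ϑ : ℝ, ϑ < 1 / 4 ∧ ∃ C : ℝ, ∀ M n n' j j' : ℕ, 1 ≤ n → 1 ≤ n' → n ≠ n' →
    n ≤ 2 * M → n' ≤ 2 * M → Nat.sqrt M + 1 ≤ j → j < 2 * (Nat.sqrt M + 1) →
    Nat.sqrt M + 1 ≤ j' → j' < 2 * (Nat.sqrt M + 1) →
      |T c n n' M j - T c n n' M j'| ≤ C * (M : ℝ) ^ (3 / 4 + ϑ)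

/-- GLUE for D5: average ∧ rigidity ⇒ crux (`Q·T_j = Σ_{j'} T_{j'} + Σ_{j'} (T_j − T_{j'})`). -/
theorem cosetDecorrelation_of_average_rigidity (hA : CosetOnAverage) (hR : CosetColumnRigidity) :
    CosetDecorrelation := by
  rw [crux_iff]
  intro c hc
  obtain ⟨ϑ₁, hϑ₁, C₁, hC₁⟩ := hA c hc
  obtain ⟨ϑ₂, hϑ₂, C₂, hC₂⟩ := hR c hc
  refine ⟨max ϑ₁ ϑ₂, max_lt hϑ₁ hϑ₂, max C₁ 0 + max C₂ 0, fun M n n' j h1 h2 h3 h4 h5 h6 h7 => ?_⟩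
  set Q := Nat.sqrt M + 1 with hQdef
  have hQ1 : 1 ≤ Q := by omega
  have hQpos : (0 : ℝ) < Q := by exact_mod_cast hQ1
  have hM : (1 : ℝ) ≤ (M : ℝ) := by exact_mod_cast (show 1 ≤ M by omega)
  have hcard : ((Ico Q (2 * Q)).card : ℝ) = Q := by
    rw [Nat.card_Ico, show 2 * Q - Q = Q by omega]
  -- `Q · T_j = Σ_{j'} T_{j'} + Σ_{j'} (T_j − T_{j'})`
  have hsplit : (Q : ℝ) * T c n n' M j =
      (∑ j' ∈ Ico Q (2 * Q), T c n n' M j') + ∑ j' ∈ Ico Q (2 * Q), (T c n n' M j - T c n n' M j') := by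
    rw [← sum_add_distrib]
    simp only [add_sub_cancel, sum_const, nsmul_eq_mul]
    rw [hcard]
  have hX : ∀ ϑ : ℝ, ϑ ≤ max ϑ₁ ϑ₂ → (M : ℝ) ^ (3 / 4 + ϑ) ≤ (M : ℝ) ^ (3 / 4 + max ϑ₁ ϑ₂) :=
    fun ϑ hϑ => Real.rpow_le_rpow_of_exponent_le hM (by linarith)
  have hXpos : ∀ ϑ : ℝ, 0 ≤ (M : ℝ) ^ (3 / 4 + ϑ) := fun ϑ => Real.rpow_nonneg (by positivity) _
  -- the average term
  have hav : |∑ j' ∈ Ico Q (2 * Q), T c n n' M j'| ≤ max C₁ 0 * Q * (M : ℝ) ^ (3 / 4 + max ϑ₁ ϑ₂) := by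
    calc |∑ j' ∈ Ico Q (2 * Q), T c n n' M j'| ≤ C₁ * Q * (M : ℝ) ^ (3 / 4 + ϑ₁) := hC₁ M n n' h1 h2 h3 h4 h5
      _ ≤ max C₁ 0 * Q * (M : ℝ) ^ (3 / 4 + ϑ₁) :=
          mul_le_mul_of_nonneg_right (mul_le_mul_of_nonneg_right (le_max_left _ _) hQpos.le) (hXpos _)
      _ ≤ max C₁ 0 * Q * (M : ℝ) ^ (3 / 4 + max ϑ₁ ϑ₂) :=
          mul_le_mul_of_nonneg_left (hX ϑ₁ (le_max_left _ _)) (by positivity)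
  -- the rigidity term
  have hrig : |∑ j' ∈ Ico Q (2 * Q), (T c n n' M j - T c n n' M j')| ≤
      max C₂ 0 * Q * (M : ℝ) ^ (3 / 4 + max ϑ₁ ϑ₂) := by
    calc |∑ j' ∈ Ico Q (2 * Q), (T c n n' M j - T c n n' M j')|
        ≤ ∑ j' ∈ Ico Q (2 * Q), |T c n n' M j - T c n n' M j'| := abs_sum_le_sum_abs _ _
      _ ≤ ∑ _j' ∈ Ico Q (2 * Q), max C₂ 0 * (M : ℝ) ^ (3 / 4 + max ϑ₁ ϑ₂) := by
          refine sum_le_sum fun j' hj' => ?_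
          rw [mem_Ico] at hj'
          calc |T c n n' M j - T c n n' M j'| ≤ C₂ * (M : ℝ) ^ (3 / 4 + ϑ₂) :=
                hC₂ M n n' j j' h1 h2 h3 h4 h5 h6 h7 hj'.1 hj'.2
            _ ≤ max C₂ 0 * (M : ℝ) ^ (3 / 4 + ϑ₂) := mul_le_mul_of_nonneg_right (le_max_left _ _) (hXpos _)
            _ ≤ max C₂ 0 * (M : ℝ) ^ (3 / 4 + max ϑ₁ ϑ₂) :=
                mul_le_mul_of_nonneg_left (hX ϑ₂ (le_max_right _ _)) (le_max_right _ _)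
      _ = max C₂ 0 * Q * (M : ℝ) ^ (3 / 4 + max ϑ₁ ϑ₂) := by
          rw [sum_const, nsmul_eq_mul, hcard]; ring
  -- assemble and divide by `Q`
  have hQT : (Q : ℝ) * |T c n n' M j| ≤
      (max C₁ 0 + max C₂ 0) * Q * (M : ℝ) ^ (3 / 4 + max ϑ₁ ϑ₂) := by
    rw [← abs_of_pos hQpos, ← abs_mul, abs_of_pos hQpos, hsplit]
    calc |(∑ j' ∈ Ico Q (2 * Q), T c n n' M j') + ∑ j' ∈ Ico Q (2 * Q), (T c n n' M j - T c n n' M j')|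
        ≤ |∑ j' ∈ Ico Q (2 * Q), T c n n' M j'| + |∑ j' ∈ Ico Q (2 * Q), (T c n n' M j - T c n n' M j')| :=
          abs_add_le _ _
      _ ≤ max C₁ 0 * Q * (M : ℝ) ^ (3 / 4 + max ϑ₁ ϑ₂) + max C₂ 0 * Q * (M : ℝ) ^ (3 / 4 + max ϑ₁ ϑ₂) :=
          add_le_add hav hrig
      _ = (max C₁ 0 + max C₂ 0) * Q * (M : ℝ) ^ (3 / 4 + max ϑ₁ ϑ₂) := by ring
  have : (Q : ℝ) * |T c n n' M j| ≤ (Q : ℝ) * ((max C₁ 0 + max C₂ 0) * (M : ℝ) ^ (3 / 4 + max ϑ₁ ϑ₂)) := by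
    calc (Q : ℝ) * |T c n n' M j| ≤ (max C₁ 0 + max C₂ 0) * Q * (M : ℝ) ^ (3 / 4 + max ϑ₁ ϑ₂) := hQT
      _ = (Q : ℝ) * ((max C₁ 0 + max C₂ 0) * (M : ℝ) ^ (3 / 4 + max ϑ₁ ϑ₂)) := by ring
  exact le_of_mul_le_mul_left this hQpos

/-! ## §N NEGATION -/

/-- **Siegel-compatible exceptional zeros have quality `< q^ε`.**  For every `ε > 0`, Siegel zeros of
quality `≥ q^ε` do NOT occur at arbitrarily large conductors (Siegel's theorem, tree:
`exists_siegelZero_quality_le`, ineffective).  Consequently every conditional-disproof route that needs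
power-quality (let alone exponential-quality) exceptional zeros infinitely often has an EMPTY hypothesis
class — in particular the Tao–Teräväinen pretender route to `¬ CosetDecorrelation` (census N2: it needs
`η ≥ q²` i.o. to push the relative error `log^{−1/10} η` below the pretender main term `1/q`). -/
theorem not_siegelZerosAbove_rpow {ε : ℝ} (hε : 0 < ε) :
    ¬ SiegelZerosAbove (fun q => (q : ℝ) ^ ε) := by
  intro hz
  obtain ⟨C, hC, hle⟩ := exists_siegelZero_quality_le (ε := ε / 2) (by positivity)
  -- choose `q₀` with `q₀^{ε/2} > C`
  obtain ⟨q₀, hq₀⟩ : ∃ q₀ : ℕ, ∀ q : ℕ, q₀ ≤ q → C < (q : ℝ) ^ (ε / 2) := by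
    have ht : Filter.Tendsto (fun q : ℕ => ((q : ℝ)) ^ (ε / 2)) Filter.atTop Filter.atTop :=
      (tendsto_rpow_atTop (by positivity)).comp tendsto_natCast_atTop_atTop
    obtain ⟨q₀, h⟩ := (ht.eventually_gt_atTop C).exists_forall_of_atTop
    exact ⟨q₀, h⟩
  obtain ⟨q, hqne, χ, η, hq₀q, hηq, hsz⟩ := hz q₀
  have hq0 : (0 : ℝ) < q := by exact_mod_cast Nat.pos_of_ne_zero (NeZero.ne q)
  have h1 : (q : ℝ) ^ ε ≤ C * (q : ℝ) ^ (ε / 2) := le_trans hηq (hle q χ η hsz)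
  have h2 : (q : ℝ) ^ ε = (q : ℝ) ^ (ε / 2) * (q : ℝ) ^ (ε / 2) := by
    rw [← Real.rpow_add hq0]; ring_nf
  have hpos : (0 : ℝ) < (q : ℝ) ^ (ε / 2) := Real.rpow_pos_of_pos hq0 _
  rw [h2] at h1
  have h3 : (q : ℝ) ^ (ε / 2) ≤ C := le_of_mul_le_mul_right h1 hpos
  exact absurd (hq₀ q hq₀q) (not_lt.mpr h3)

end Summit.Parity.GeneralizedHardyLittlewood.Cruxes.CosetDecorrelation.StrategyCensus

end
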